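import Summits.ABC.ABC.Theses.CubicResolventAllowance
import Summits.ABC.ABC.Theorems.PlaceCountSzpiroDiscLeJHeight
import Summits.ABC.ABC.Theorems.PlacewiseSzpiroSingleTowerSzpiroPrimeConductor

/-!
# Stub ideation k=1 for `stub_realCubic` (family 1: recognise & import), rev 2 — helper signatures,
crux `IndexSzpiro` (stmt-ABC-22740), route `CubicResolventAllowance`.

File `Cruxes/IndexSzpiro/StubIdeas1RealSketch.lean`, namespace `…Cruxes.IndexSzpiro.StubIdeas1Real`
(the name `StubIdeas1Sketch.lean` / namespace `…StubIdeas1` belongs to the `stub_complexCubic` k=1 seat;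
see the signpost in that file). Companion plan: `STUB-IDEAS-stub_realCubic-1.md` (rev 2).

SKETCH ONLY. Every `theorem … := by sorry` below is a PROPOSED helper lemma (≤ 1 prover cycle each,
unless marked OPEN); the `sorry`-free theorems are bookkeeping glue showing how the helpers assemble
into the stub. Nothing here is progress on abc/Szpiro; typed ≠ proved.

Levers owned by k=1 (k=3 owns the parity transfer `Δ = r²·d_K`, its H1–H4/Hsign/`SquareCore` — cited
here as the Props `SqfKernelDvdDiscr`, `SignLemma`, not retyped):
* Plan A — TWIST NORMALISATION: WLOG every odd pole of `j` is multiplicative (`OddPolesSemistable`);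
  `ReducedStubRealCubic → StubRealCubic` by strong induction on `N`, one `p*`-twist at a time
  (the tree's `SingleTowerSzpiroLine` twist API: `conductorExponent_twistModel_pstar_eq_one`,
  `conductorExponent_twistModel_pstar_of_ne`, `natGenerator_mul_conductorNorm_twist_dvd`,
  `ordMinimalDiscriminant_le_twist_add_six`, `WeierstrassCurve.ordMinimalDiscriminant_twistModel`).
* Plan B — CALIBRATION RUNG modulo the named fact `mestreOesterle1989_thm_1`: odd prime-power
  conductor ⇒ `Δ_min ≤ N⁶` (ε-free stub instance, `C = 1`, any `K`).
* Plan C — the K-free, sign-explicit RESIDUAL CORE on the normal form (`ReducedRealSquareCore`, OPEN,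
  Szpiro-strength on its class) + proved glue `core ∧ H3 ∧ Hsign ⇒ ReducedStub ⇒ Stub`.
-/

set_option linter.dupNamespace false

noncomputable section

namespace Summit.ABC.ABC.Cruxes.IndexSzpiro.StubIdeas1Real

open IsDedekindDomain Rat.HeightOneSpectrum
open Summit.ABC.ABC.Theses.CubicResolventAllowance
open Summit.ABC.ABC.Theorems.SingleTowerSzpiroLine Summit.ABC.ABC.Theorems.DiscLeJHeight
open Literature.NumberTheory.EllipticCurves Literature.NumberTheory.DiophantineGeometry

/-! ## The registered stub, verbatim, as a Prop -/

/-- `stub_realCubic` (the `d_K > 0` half of `IndexSzpiro`), verbatim registered signature. -/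
def StubRealCubic : Prop :=
  ∀ ε : ℝ, 0 < ε → ∃ C : ℝ, ∀ (W : WeierstrassCurve ℚ) [W.IsElliptic] (K : Type) [Field K]
    [NumberField K], Irreducible W.twoTorsionPolynomial.toPoly → Module.finrank ℚ K = 3 →
    (∃ θ : K, Polynomial.aeval θ W.twoTorsionPolynomial.toPoly = 0) → 0 < NumberField.discr K →
    (W.minimalDiscriminantNorm ℤ : ℝ) ≤
      C * |(NumberField.discr K : ℝ)| * (W.conductorNorm ℤ : ℝ) ^ (6 + ε)

/-! ## Plan A — twist normalisation (WLOG every odd pole of `j` is multiplicative) -/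

/-- NORMAL FORM: at every odd place where `j` has a pole the reduction is multiplicative (no odd place of
additive, potentially multiplicative reduction). Reached from any `E` by finitely many twists by `p*`. -/
def OddPolesSemistable (W : WeierstrassCurve ℚ) [W.IsElliptic] : Prop :=
  ∀ v : HeightOneSpectrum ℤ, natGenerator v ≠ 2 → 1 < v.valuation ℚ W.j → W.conductorExponent v = 1

/-- The stub restricted to the normal form. -/
def ReducedStubRealCubic : Prop :=
  ∀ ε : ℝ, 0 < ε → ∃ C : ℝ, ∀ (W : WeierstrassCurve ℚ) [W.IsElliptic] (K : Type) [Field K]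
    [NumberField K], Irreducible W.twoTorsionPolynomial.toPoly → Module.finrank ℚ K = 3 →
    (∃ θ : K, Polynomial.aeval θ W.twoTorsionPolynomial.toPoly = 0) → 0 < NumberField.discr K →
    OddPolesSemistable W →
    (W.minimalDiscriminantNorm ℤ : ℝ) ≤
      C * |(NumberField.discr K : ℝ)| * (W.conductorNorm ℤ : ℝ) ^ (6 + ε)

/-- Trivial direction (the reduction loses nothing). -/
theorem reducedStubRealCubic_of_stub (h : StubRealCubic) : ReducedStubRealCubic := by
  intro ε hε
  obtain ⟨C, hC⟩ := h ε hε
  exact ⟨C, fun W _ K _ _ hirr hdeg hθ hpos _ => hC W K hirr hdeg hθ hpos⟩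

section PlanA

/-- **A0** (proved) the twist model by `k`, `4k + 1 ≠ 0`, of an elliptic curve is elliptic
(`WeierstrassCurve.twistModel_Δ : Δ ↦ (4k+1)⁶ Δ`). -/
theorem isElliptic_twistModel (W : WeierstrassCurve ℚ) [W.IsElliptic] (k : ℚ) (hk : 4 * k + 1 ≠ 0) :
    (W.twistModel k).IsElliptic :=
  ⟨by rw [WeierstrassCurve.twistModel_Δ]; exact (IsUnit.mk0 _ (pow_ne_zero 6 hk)).mul W.isUnit_Δ⟩

/-- **A1** the 2-division cubic of the twist model is the rescaled one: `ψ₂^{(k)} = ⟨4, d b₂, 2d² b₄, d³ b₆⟩`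
(`twistModel_b₂/b₄/b₆`), so `ψ₂^{(k)}(d·x) = d³ ψ₂(x)`: a root `θ ∈ K` of `ψ₂` gives the root `d θ` of
`ψ₂^{(k)}` in the SAME cubic field `K` (the resolvent field is a twist invariant). One prover cycle
(proved: `simp [Cubic.toPoly]` + `ring`). -/
theorem aeval_twistModel_twoTorsionPolynomial (W : WeierstrassCurve ℚ) (k : ℚ) (K : Type) [Field K]
    [NumberField K] (θ : K) (hθ : Polynomial.aeval θ W.twoTorsionPolynomial.toPoly = 0) :
    Polynomial.aeval (algebraMap ℚ K (4 * k + 1) * θ) (W.twistModel k).twoTorsionPolynomial.toPoly = 0 := by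
  have key : Polynomial.aeval (algebraMap ℚ K (4 * k + 1) * θ) (W.twistModel k).twoTorsionPolynomial.toPoly
      = (algebraMap ℚ K (4 * k + 1)) ^ 3 * Polynomial.aeval θ W.twoTorsionPolynomial.toPoly := by
    simp only [WeierstrassCurve.twoTorsionPolynomial, Cubic.toPoly, WeierstrassCurve.twistModel_b₂,
      WeierstrassCurve.twistModel_b₄, WeierstrassCurve.twistModel_b₆, map_add, map_mul, map_pow,
      Polynomial.aeval_C, Polynomial.aeval_X]
    ring
  rw [key, hθ, mul_zero]

/-- **A2** irreducibility of `ψ₂` over `ℚ` is a twist invariant (`4k+1 ≠ 0`): the `ℚ`-roots scale by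
`d = 4k+1` (A1 with `K = ℚ` both ways, inverse twist `twistModel_twistModel_neg_mul_inv`), and a cubic
over a field is irreducible iff it has no root (`Polynomial.irreducible_iff_roots_eq_zero_of_degree_le_three`,
`Cubic.natDegree_of_a_ne_zero`). One prover cycle. -/
theorem irreducible_twoTorsionPolynomial_twistModel_iff (W : WeierstrassCurve ℚ) (k : ℚ)
    (hk : 4 * k + 1 ≠ 0) :
    Irreducible (W.twistModel k).twoTorsionPolynomial.toPoly ↔
      Irreducible W.twoTorsionPolynomial.toPoly := by
  sorry

/-- **A3** (proved) `j` is a twist invariant (pattern of `DiscLeJHeight.ordMinimalDiscriminant_le_den_add_six`). -/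
theorem j_twistModel (W : WeierstrassCurve ℚ) [W.IsElliptic] (k : ℚ) (hk : 4 * k + 1 ≠ 0)
    [(W.twistModel k).IsElliptic] : (W.twistModel k).j = W.j := by
  obtain ⟨C, -, hC⟩ := W.exists_variableChange_twistModel_eq_quadraticTwist k
  haveI : (W.quadraticTwist (4 * k + 1)).IsElliptic := W.isElliptic_quadraticTwist hk
  calc (W.twistModel k).j = (C • W.twistModel k).j :=
        (WeierstrassCurve.variableChange_j (W.twistModel k) C).symm
    _ = (W.quadraticTwist (4 * k + 1)).j := j_eq_of_eq hC
    _ = W.j := WeierstrassCurve.j_quadraticTwist W hk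

/-- **A4** ONE TWIST STEP (the package). At an odd place `v` of additive, potentially multiplicative
reduction, the twist by `p* = ±p_v ≡ 1 (4)` (`k = (p*−1)/4`, `exists_sign_four_mul_add_one`) is
multiplicative at `v` (`conductorExponent_twistModel_pstar_eq_one`), has the same exponents elsewhere
(`conductorExponent_twistModel_pstar_of_ne`), `p·N₁ ∣ N` (`natGenerator_mul_conductorNorm_twist_dvd`,
`two_le_conductorExponent_of_not_hasMultiplicativeReductionAt`), and `Δ_min(E) ∣ p⁶ Δ_min(E₁)`
(`ordMinimalDiscriminant_le_twist_add_six` at `v`, `WeierstrassCurve.ordMinimalDiscriminant_twistModel`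
off `v`, `factorization_minimalDiscriminantNorm_holds`). Assembly of landed lemmas; one prover cycle.
[Silverman ATAEC IV.9.4 Step 7, Ex. 4.37] -/
theorem exists_twist_step (W : WeierstrassCurve ℚ) [W.IsElliptic] (v : HeightOneSpectrum ℤ)
    (hp2 : natGenerator v ≠ 2) (hf : W.conductorExponent v ≠ 1) (hj : 1 < v.valuation ℚ W.j) :
    ∃ k : ℤ, ∃ hk : 4 * (k : ℚ) + 1 ≠ 0,
      haveI := isElliptic_twistModel W (k : ℚ) hk
      (W.twistModel (k : ℚ)).conductorExponent v = 1 ∧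
      (∀ w : HeightOneSpectrum ℤ, w ≠ v →
        (W.twistModel (k : ℚ)).conductorExponent w = W.conductorExponent w) ∧
      natGenerator v * (W.twistModel (k : ℚ)).conductorNorm ℤ ∣ W.conductorNorm ℤ ∧
      W.minimalDiscriminantNorm ℤ ∣
        natGenerator v ^ 6 * (W.twistModel (k : ℚ)).minimalDiscriminantNorm ℤ := by
  sorry

/-- **A5** (proved from A1, A2, A4) REDUCTION: the stub follows from its normal-form case, same `ε`,
constant `max C 0`. Strong induction on `N`: a non-reduced `E` has an odd additive pole `v`; twist it
away (`N₁ ≤ N/p < N`, same `K`, same irreducibility), and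
`Δ_min(E) ≤ p⁶ Δ_min(E₁) ≤ p⁶ · C|d_K| N₁^{6+ε} ≤ C|d_K| (p N₁)^{6+ε} ≤ C|d_K| N^{6+ε}`. -/
theorem stubRealCubic_of_reduced (h : ReducedStubRealCubic) : StubRealCubic := by
  intro ε hε
  obtain ⟨C, hC⟩ := h ε hε
  refine ⟨max C 0, ?_⟩
  intro W _ K _ _ hirr hdeg hθ hpos
  suffices H : ∀ (n : ℕ) (W : WeierstrassCurve ℚ) [W.IsElliptic], W.conductorNorm ℤ = n →
      Irreducible W.twoTorsionPolynomial.toPoly →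
      (∃ θ : K, Polynomial.aeval θ W.twoTorsionPolynomial.toPoly = 0) →
      (W.minimalDiscriminantNorm ℤ : ℝ) ≤
        max C 0 * |(NumberField.discr K : ℝ)| * (W.conductorNorm ℤ : ℝ) ^ (6 + ε) from
    H _ W rfl hirr hθ
  intro n
  induction n using Nat.strong_induction_on with
  | _ n ih =>
    intro W _ hn hirr hθ
    by_cases hred : OddPolesSemistable W
    · calc (W.minimalDiscriminantNorm ℤ : ℝ)
          ≤ C * |(NumberField.discr K : ℝ)| * (W.conductorNorm ℤ : ℝ) ^ (6 + ε) :=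
            hC W K hirr hdeg hθ hpos hred
        _ ≤ max C 0 * |(NumberField.discr K : ℝ)| * (W.conductorNorm ℤ : ℝ) ^ (6 + ε) := by
            have h1 : C ≤ max C 0 := le_max_left _ _
            have h2 : (0 : ℝ) ≤ |(NumberField.discr K : ℝ)| * (W.conductorNorm ℤ : ℝ) ^ (6 + ε) := by
              positivity
            nlinarith
    · -- an odd additive pole `v`: twist it away
      simp only [OddPolesSemistable, not_forall] at hred
      obtain ⟨v, hp2, hj, hf⟩ := hred
      obtain ⟨k, hk, hf1, -, hNdvd, hΔdvd⟩ := exists_twist_step W v hp2 hf hj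
      haveI hE₁ : (W.twistModel (k : ℚ)).IsElliptic := isElliptic_twistModel W (k : ℚ) hk
      have hpp : (natGenerator v).Prime := prime_natGenerator v
      have hN₁pos : 0 < (W.twistModel (k : ℚ)).conductorNorm ℤ :=
        WeierstrassCurve.conductorNorm_pos_holds (W.twistModel (k : ℚ))
      have hNpos : 0 < W.conductorNorm ℤ := WeierstrassCurve.conductorNorm_pos_holds W
      have hle : natGenerator v * (W.twistModel (k : ℚ)).conductorNorm ℤ ≤ W.conductorNorm ℤ :=
        Nat.le_of_dvd hNpos hNdvd
      have hlt : (W.twistModel (k : ℚ)).conductorNorm ℤ < n := by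
        rw [← hn]
        calc (W.twistModel (k : ℚ)).conductorNorm ℤ < 2 * (W.twistModel (k : ℚ)).conductorNorm ℤ := by
              omega
          _ ≤ natGenerator v * (W.twistModel (k : ℚ)).conductorNorm ℤ :=
              Nat.mul_le_mul_right _ hpp.two_le
          _ ≤ W.conductorNorm ℤ := hle
      have hirr₁ : Irreducible (W.twistModel (k : ℚ)).twoTorsionPolynomial.toPoly :=
        (irreducible_twoTorsionPolynomial_twistModel_iff W (k : ℚ) hk).mpr hirr
      obtain ⟨θ, hθ⟩ := hθ
      have hθ₁ : ∃ θ₁ : K, Polynomial.aeval θ₁ (W.twistModel (k : ℚ)).twoTorsionPolynomial.toPoly = 0 :=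
        ⟨_, aeval_twistModel_twoTorsionPolynomial W (k : ℚ) K θ hθ⟩
      have ih₁ := ih ((W.twistModel (k : ℚ)).conductorNorm ℤ) hlt (W.twistModel (k : ℚ)) rfl hirr₁ hθ₁
      -- real arithmetic
      have hC0 : 0 ≤ max C 0 := le_max_right _ _
      have hD0 : (0 : ℝ) ≤ |(NumberField.discr K : ℝ)| := abs_nonneg _
      have hp1 : (1 : ℝ) ≤ (natGenerator v : ℝ) := by exact_mod_cast hpp.one_lt.le
      have hN₁r : (0 : ℝ) ≤ ((W.twistModel (k : ℚ)).conductorNorm ℤ : ℝ) := by positivity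
      have hΔle : (W.minimalDiscriminantNorm ℤ : ℝ) ≤
          (natGenerator v : ℝ) ^ (6 : ℕ) * ((W.twistModel (k : ℚ)).minimalDiscriminantNorm ℤ : ℝ) := by
        have := Nat.le_of_dvd (Nat.mul_pos (pow_pos hpp.pos 6)
          (WeierstrassCurve.minimalDiscriminantNorm_pos_holds (W.twistModel (k : ℚ)))) hΔdvd
        exact_mod_cast this
      have hp6 : (natGenerator v : ℝ) ^ (6 : ℕ) ≤ (natGenerator v : ℝ) ^ (6 + ε) := by
        rw [← Real.rpow_natCast]
        exact Real.rpow_le_rpow_of_exponent_le hp1 (by push_cast; linarith)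
      have hprod : (natGenerator v : ℝ) ^ (6 + ε) * ((W.twistModel (k : ℚ)).conductorNorm ℤ : ℝ) ^ (6 + ε)
          = ((natGenerator v : ℝ) * ((W.twistModel (k : ℚ)).conductorNorm ℤ : ℝ)) ^ (6 + ε) :=
        (Real.mul_rpow (by positivity) hN₁r).symm
      have hmono : ((natGenerator v : ℝ) * ((W.twistModel (k : ℚ)).conductorNorm ℤ : ℝ)) ^ (6 + ε) ≤
          (W.conductorNorm ℤ : ℝ) ^ (6 + ε) := by
        apply Real.rpow_le_rpow (by positivity) ?_ (by linarith)
        exact_mod_cast hle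
      calc (W.minimalDiscriminantNorm ℤ : ℝ)
          ≤ (natGenerator v : ℝ) ^ (6 : ℕ) * ((W.twistModel (k : ℚ)).minimalDiscriminantNorm ℤ : ℝ) := hΔle
        _ ≤ (natGenerator v : ℝ) ^ (6 : ℕ) * (max C 0 * |(NumberField.discr K : ℝ)| *
              ((W.twistModel (k : ℚ)).conductorNorm ℤ : ℝ) ^ (6 + ε)) :=
            mul_le_mul_of_nonneg_left ih₁ (by positivity)
        _ ≤ (natGenerator v : ℝ) ^ (6 + ε) * (max C 0 * |(NumberField.discr K : ℝ)| *
              ((W.twistModel (k : ℚ)).conductorNorm ℤ : ℝ) ^ (6 + ε)) :=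
            mul_le_mul_of_nonneg_right hp6 (by positivity)
        _ = max C 0 * |(NumberField.discr K : ℝ)| * ((natGenerator v : ℝ) ^ (6 + ε) *
              ((W.twistModel (k : ℚ)).conductorNorm ℤ : ℝ) ^ (6 + ε)) := by ring
        _ = max C 0 * |(NumberField.discr K : ℝ)| *
              ((natGenerator v : ℝ) * ((W.twistModel (k : ℚ)).conductorNorm ℤ : ℝ)) ^ (6 + ε) := by
            rw [hprod]
        _ ≤ max C 0 * |(NumberField.discr K : ℝ)| * (W.conductorNorm ℤ : ℝ) ^ (6 + ε) :=
            mul_le_mul_of_nonneg_left hmono (mul_nonneg hC0 hD0)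

end PlanA

/-! ## Plan B — calibration rung modulo Mestre–Oesterlé: odd prime-power conductor -/

section PlanB

/-- **B1** (mod M–O) `N = p²`, `p` odd ⇒ `Δ_min ∣ p¹¹`. Pole case (`ord_p j < 0`, `f_p = 2 ≠ 1`): the
`p*`-twist has conductor `p` (A4), so `Δ_min(E₁) ∣ p⁵` (`hMO`) and `Δ_min(E) ∣ p⁶ Δ_min(E₁)`;
integral-`j` case: `ord_p Δ_min ≤ f_p + 8 = 10` (`ordMinimalDiscriminant_le_conductorExponent_add_eight`).
One prover cycle. -/
theorem minimalDiscriminantNorm_dvd_pow_eleven (hMO : mestreOesterle1989_thm_1)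
    (W : WeierstrassCurve ℚ) [W.IsElliptic] {p : ℕ} (hp : p.Prime) (hp2 : p ≠ 2)
    (hN : W.conductorNorm ℤ = p ^ 2) : W.minimalDiscriminantNorm ℤ ∣ p ^ 11 := by
  sorry

/-- **B2** (mod M–O) odd prime-power conductor ⇒ `Δ_min ≤ N⁶`: `N = p` (`hMO`: `∣ p⁵`), `N = p²` (B1),
`N = p^f`, `f ≥ 3` ⇒ `p = 3` potentially good, `ord₃ Δ_min ≤ f + 8 ≤ 6f`
(`conductorExponent_le_two_of_five_le`-type bounds for `p ≥ 5`, `…_add_eight` at `3`). One prover cycle. -/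
theorem minimalDiscriminantNorm_le_pow_six_of_isPrimePow (hMO : mestreOesterle1989_thm_1)
    (W : WeierstrassCurve ℚ) [W.IsElliptic] (hN : IsPrimePow (W.conductorNorm ℤ))
    (hodd : Odd (W.conductorNorm ℤ)) : W.minimalDiscriminantNorm ℤ ≤ W.conductorNorm ℤ ^ 6 := by
  sorry

/-- **B3** (proved from B2) the rung in stub currency: ε-free `stub_realCubic` with `C = 1` on odd
prime-power conductor, for ANY field `K` (the allowance is not even used — calibration, inside the
regime where Szpiro(6) is known modulo M–O; not a BC5 witness). -/
theorem stubRealCubic_rung_primePow (hMO : mestreOesterle1989_thm_1) (W : WeierstrassCurve ℚ)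
    [W.IsElliptic] (K : Type) [Field K] [NumberField K] (hN : IsPrimePow (W.conductorNorm ℤ))
    (hodd : Odd (W.conductorNorm ℤ)) :
    (W.minimalDiscriminantNorm ℤ : ℝ) ≤
      1 * |(NumberField.discr K : ℝ)| * (W.conductorNorm ℤ : ℝ) ^ (6 : ℝ) := by
  have h := minimalDiscriminantNorm_le_pow_six_of_isPrimePow hMO W hN hodd
  have hd : (1 : ℝ) ≤ |(NumberField.discr K : ℝ)| := by
    have h0 : NumberField.discr K ≠ 0 := NumberField.discr_ne_zero K
    have h1 : (1 : ℤ) ≤ |NumberField.discr K| := Int.one_le_abs h0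
    have h2 : ((1 : ℤ) : ℝ) ≤ ((|NumberField.discr K| : ℤ) : ℝ) := by exact_mod_cast h1
    simpa [Int.cast_abs] using h2
  have hR : (W.minimalDiscriminantNorm ℤ : ℝ) ≤ (W.conductorNorm ℤ : ℝ) ^ (6 : ℝ) := by
    rw [show (6 : ℝ) = ((6 : ℕ) : ℝ) by norm_num, Real.rpow_natCast]
    exact_mod_cast h
  calc (W.minimalDiscriminantNorm ℤ : ℝ) ≤ (W.conductorNorm ℤ : ℝ) ^ (6 : ℝ) := hR
    _ = 1 * 1 * (W.conductorNorm ℤ : ℝ) ^ (6 : ℝ) := by ring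
    _ ≤ 1 * |(NumberField.discr K : ℝ)| * (W.conductorNorm ℤ : ℝ) ^ (6 : ℝ) :=
        mul_le_mul_of_nonneg_right (mul_le_mul_of_nonneg_left hd zero_le_one) (by positivity)

end PlanB

/-! ## Plan C — the K-free residual core on the normal form, and the glue -/

section PlanC

/-- k=3's **H3** as a hypothesis (typed in `StubIdeas3Sketch.squarefreePart_dvd_discr`; not retyped as a
target here): the squarefree kernel of `Δ_min` divides `d_K`. -/
def SqfKernelDvdDiscr : Prop :=
  ∀ (W : WeierstrassCurve ℚ) [W.IsElliptic] (K : Type) [Field K] [NumberField K],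
    Irreducible W.twoTorsionPolynomial.toPoly → Module.finrank ℚ K = 3 →
    (∃ θ : K, Polynomial.aeval θ W.twoTorsionPolynomial.toPoly = 0) →
    ∀ m s : ℕ, m ^ 2 * s = W.minimalDiscriminantNorm ℤ → Squarefree s → (s : ℤ) ∣ NumberField.discr K

/-- k=3's **Hsign** as a hypothesis (`StubIdeas3Sketch.discr_pos_iff_Δ_pos`): `d_K > 0 ⟺ Δ(E) > 0`. -/
def SignLemma : Prop :=
  ∀ (W : WeierstrassCurve ℚ) [W.IsElliptic] (K : Type) [Field K] [NumberField K],
    Irreducible W.twoTorsionPolynomial.toPoly → Module.finrank ℚ K = 3 →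
    (∃ θ : K, Polynomial.aeval θ W.twoTorsionPolynomial.toPoly = 0) →
    (0 < NumberField.discr K ↔ 0 < W.Δ)

/-- **The residual core of `stub_realCubic` after Plans A and k3-A** (K-free; sign = `Δ > 0`; normal form):
Szpiro(6+ε) for the SQUARE PART of `Δ_min` on `{ψ₂ irreducible, Δ > 0, odd poles multiplicative}`.
OPEN — Szpiro-strength on its class (no import closes it: Stewart–Yu is exponential, Mestre–Oesterlé is
`N` prime only, Bennett–Yazdani needs rational 2-torsion); filed so the critic can name it, not to be
claimed by a prover. -/
def ReducedRealSquareCore : Prop :=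
  ∀ ε : ℝ, 0 < ε → ∃ C : ℝ, ∀ (W : WeierstrassCurve ℚ) [W.IsElliptic],
    Irreducible W.twoTorsionPolynomial.toPoly → 0 < W.Δ → OddPolesSemistable W → ∀ m : ℕ,
      m ^ 2 ∣ W.minimalDiscriminantNorm ℤ → ((m : ℝ) ^ 2 ≤ C * (W.conductorNorm ℤ : ℝ) ^ (6 + ε))

/-- **Glue C** (proved): core + H3 + Hsign ⇒ the reduced stub, constant unchanged
(`Δ_min = m²·s ≤ C N^{6+ε} · s ≤ C N^{6+ε} · |d_K|` since `s ∣ d_K ≠ 0`). -/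
theorem reducedStub_of_core (hcore : ReducedRealSquareCore) (hH3 : SqfKernelDvdDiscr)
    (hsign : SignLemma) : ReducedStubRealCubic := by
  intro ε hε
  obtain ⟨C, hC⟩ := hcore ε hε
  refine ⟨C, ?_⟩
  intro W _ K _ _ hirr hdeg hθ hpos hred
  have hΔpos : 0 < W.Δ := (hsign W K hirr hdeg hθ).mp hpos
  obtain ⟨s, m, -, -, hms, hs⟩ :=
    Nat.sq_mul_squarefree_of_pos (WeierstrassCurve.minimalDiscriminantNorm_pos_holds W)
  have hsd : (s : ℤ) ∣ NumberField.discr K := hH3 W K hirr hdeg hθ m s hms hs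
  have hd0 : NumberField.discr K ≠ 0 := NumberField.discr_ne_zero K
  have hsle : (s : ℝ) ≤ |(NumberField.discr K : ℝ)| := by
    have h1 : (s : ℤ) ≤ |NumberField.discr K| :=
      Int.le_of_dvd (abs_pos.mpr hd0) ((dvd_abs _ _).mpr hsd)
    have h2 : ((s : ℤ) : ℝ) ≤ ((|NumberField.discr K| : ℤ) : ℝ) := by exact_mod_cast h1
    simpa [Int.cast_abs] using h2
  have hm : (m : ℝ) ^ 2 ≤ C * (W.conductorNorm ℤ : ℝ) ^ (6 + ε) :=
    hC W hirr hΔpos hred m ⟨s, hms.symm⟩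
  have hCN : 0 ≤ C * (W.conductorNorm ℤ : ℝ) ^ (6 + ε) := le_trans (by positivity) hm
  have hcast : (W.minimalDiscriminantNorm ℤ : ℝ) = (m : ℝ) ^ 2 * (s : ℝ) := by
    rw [← hms]; push_cast; ring
  rw [hcast]
  calc (m : ℝ) ^ 2 * (s : ℝ) ≤ (C * (W.conductorNorm ℤ : ℝ) ^ (6 + ε)) * (s : ℝ) :=
        mul_le_mul_of_nonneg_right hm (Nat.cast_nonneg _)
    _ ≤ (C * (W.conductorNorm ℤ : ℝ) ^ (6 + ε)) * |(NumberField.discr K : ℝ)| :=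
        mul_le_mul_of_nonneg_left hsle hCN
    _ = C * |(NumberField.discr K : ℝ)| * (W.conductorNorm ℤ : ℝ) ^ (6 + ε) := by ring

/-- **Full assembly** (proved): core + H3 + Hsign ⇒ `stub_realCubic` (via Plan A). -/
theorem stubRealCubic_of_core (hcore : ReducedRealSquareCore) (hH3 : SqfKernelDvdDiscr)
    (hsign : SignLemma) : StubRealCubic :=
  stubRealCubic_of_reduced (reducedStub_of_core hcore hH3 hsign)

end PlanC

end Summit.ABC.ABC.Cruxes.IndexSzpiro.StubIdeas1Real

end
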